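import Literature.NumberTheory.Automorphic.SmoothInductionSphericalLine
import HarnessLib

/-!
# The `K′`-fixed vectors of `Ind_H^G σ` as `H ∩ K`-equivariant functions on the finite set `K ⧸ K′` (`G = H · K`, `K′ ≤ K` open)
# — the model on which `π(f)` becomes a kernel operator (van Dijk 1972; Bernstein–Zelevinsky 1977 §2.3)

Topic `NumberTheory/Automorphic`; namespace `Representation` (dot-extensions of ★ `SmoothInduction`, as ★ `SmoothInductionSphericalLine`).  THEOREMS ONLY (no
definition, no instance, no notation, no named fact, no `sorry`).  Cell `pub/hodgecm-mathlib`, line «CMCharIdentityTest» — brick VD-2 of the `stub_vanDijkGL` road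
(census `B-provers/B-p18/g31/CENSUS-VD-vanDijkGL-road.B-p18g31.md`; VD-1 = ★ `Literature/LinearAlgebra/FiniteKernelOperatorTrace`).

SETTING: a topological group `G`, subgroups `H, K ≤ G` with `G = H · K` (`hGK`, Iwasawa type), `K′ ≤ K` (the level), a representation `σ` of `H` on `W`,
the smooth induction ★ `smoothIndRep H σ` on ★ `SmoothInd H σ` (functions `f : G → W`, `f(hg) = σ h f(g)`, right translation).  Write `Y := K ⧸ K′` (left cosets
`κK′`, the finite set `↥K ⧸ K′.subgroupOf K` when `K` is compact and `K′` open).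
* §1 **restriction to `K ⧸ K′`**: `exists_restrictQuot` — a `k`-linear map `R : (Ind σ)^{K′} → (Y → W)` with `R f ⟦κ⟧ = f(κ)` (well defined by right
  `K′`-invariance); `restrictQuot_injective` — `R` is injective when `G = H · K` (`f(hκ) = σ h f(κ)`); `restrictQuot_equivariant` — every `R f` is
  `(H ∩ K, σ)`-EQUIVARIANT: `F ⟦p κ⟧ = σ p (F ⟦κ⟧)` for `p ∈ K ∩ H`.
* §2 **the image**: `exists_preimage_of_equivariant` — for `K′` OPEN, `K′ ≤ K`, `G = H · K`, every `(H ∩ K, σ)`-equivariant `F : Y → W` is `R f` for a (unique)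
  `f ∈ (Ind σ)^{K′}` (the vector `hκ ↦ σ h F⟦κ⟧`, smooth because the open `K′` fixes it — the construction of ★ `exists_mem_fixedPoints_toFun_eq` with a
  `Y`-indexed family of values); `mem_range_restrictQuot_iff`.
So `(Ind_H^G σ)^{K′} ≅ {F : K ⧸ K′ → W equivariant}` — [BernsteinZelevinsky1977 §2.3; CartierCorvallis1979 §III.3 «by the Iwasawa decomposition a function in
`I(σ)` is determined by its restriction to `K`»]; VD-3∕VD-4 read `π(f)|_{(Ind σ)^{K′}}` on this model as a kernel operator and take its trace (★ VD-1
`trace_eq_sum_diag_of_eq_kernelOp`).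
HONEST LABEL: HC_CM is proved only modulo the printed citations (2 remaining named inputs hLiu418, h413) until rung 0 closes; this file is representation-
theoretic plumbing.

## References
* [BernsteinZelevinsky1977] I. N. Bernstein, A. V. Zelevinsky, *Induced representations of reductive 𝔭-adic groups I*, Ann. Sci. ÉNS 10 (1977), §2.3.
* [CartierCorvallis1979] P. Cartier, *Representations of 𝔭-adic groups: a survey*, PSPM 33.1 (1979), §III.3.
* [vanDijk1972] G. van Dijk, *Computation of certain induced characters of 𝔭-adic groups*, Math. Ann. 199 (1972), 229–240.
-/

set_option autoImplicit false

noncomputable section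

namespace Representation

variable {k G W : Type*} [CommRing k] [Group G] [TopologicalSpace G] [SeparatelyContinuousMul G] [AddCommGroup W] [Module k W]
  (H K : Subgroup G) (σ : Representation k H W) (K' : Subgroup G)

/-! ## §1 Restriction to `K ⧸ K′` -/

/-- Right `K′`-invariance of a `K′`-fixed vector, read on `K`: `f(κ₁) = f(κ₂)` when `κ₁ K′ = κ₂ K′`. [cite: BernsteinZelevinsky1977, §2.3] -/
theorem toFun_eq_of_leftRel {f : SmoothInd H σ} (hf : f ∈ (smoothIndRep H σ).fixedPoints K') {κ₁ κ₂ : K}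
    (h : QuotientGroup.leftRel (K'.subgroupOf K) κ₁ κ₂) : f.toFun (κ₁ : G) = f.toFun (κ₂ : G) := by
  rw [QuotientGroup.leftRel_apply, Subgroup.mem_subgroupOf, Subgroup.coe_mul, Subgroup.coe_inv] at h
  have := (mem_fixedPoints_smoothIndRep_iff H K' σ f).1 hf _ h (κ₁ : G)
  rw [mul_inv_cancel_left] at this
  exact this.symm

/-- **The restriction map `R : (Ind_H^G σ)^{K′} →ₗ (K ⧸ K′ → W)`, `R f ⟦κ⟧ = f(κ)`** (well defined by right `K′`-invariance; `k`-linear).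
[cite: BernsteinZelevinsky1977, §2.3] [cite: CartierCorvallis1979, §III.3] -/
theorem exists_restrictQuot :
    ∃ R : ↥((smoothIndRep H σ).fixedPoints K') →ₗ[k] (↥K ⧸ K'.subgroupOf K → W),
      ∀ (f : ↥((smoothIndRep H σ).fixedPoints K')) (κ : K), R f (QuotientGroup.mk κ) = (f : SmoothInd H σ).toFun (κ : G) := by
  refine ⟨{ toFun := fun f => Quotient.lift (fun κ : K => (f : SmoothInd H σ).toFun (κ : G)) fun κ₁ κ₂ h => toFun_eq_of_leftRel H K σ K' f.2 h
            map_add' := fun f g => funext fun q => Quotient.inductionOn q fun κ => ?_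
            map_smul' := fun c f => funext fun q => Quotient.inductionOn q fun κ => ?_ }, fun f κ => rfl⟩
  · show ((f : SmoothInd H σ) + (g : SmoothInd H σ)).toFun (κ : G) = (f : SmoothInd H σ).toFun κ + (g : SmoothInd H σ).toFun κ
    rw [SmoothInd.toFun_add, Pi.add_apply]
  · show (c • (f : SmoothInd H σ)).toFun (κ : G) = c • (f : SmoothInd H σ).toFun κ
    rw [SmoothInd.toFun_smul, Pi.smul_apply]

variable {H K σ K'} in
/-- **`R` is injective when `G = H · K`**: a `K′`-fixed `f` vanishing on `K` vanishes (`f(hκ) = σ h f(κ)`). [cite: CartierCorvallis1979, §III.3] -/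
theorem restrictQuot_injective (hGK : ∀ g : G, ∃ h : H, ∃ κ ∈ K, g = h * κ)
    (R : ↥((smoothIndRep H σ).fixedPoints K') →ₗ[k] (↥K ⧸ K'.subgroupOf K → W))
    (hR : ∀ (f : ↥((smoothIndRep H σ).fixedPoints K')) (κ : K), R f (QuotientGroup.mk κ) = (f : SmoothInd H σ).toFun (κ : G)) :
    Function.Injective R := by
  refine (injective_iff_map_eq_zero R).2 fun f hf => Subtype.ext (SmoothInd.ext (funext fun g => ?_))
  obtain ⟨h, κ, hκ, rfl⟩ := hGK g
  have h0 : (f : SmoothInd H σ).toFun κ = 0 := by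
    rw [← hR f ⟨κ, hκ⟩, hf, Pi.zero_apply]
  have hz : (0 : SmoothInd H σ).toFun = 0 := rfl
  show (f : SmoothInd H σ).toFun (h * κ) = (0 : SmoothInd H σ).toFun (h * κ)
  rw [(f : SmoothInd H σ).toFun_subgroup_mul, h0, map_zero, hz, Pi.zero_apply]

variable {H K σ K'} in
/-- **Every `R f` is `(H ∩ K, σ)`-equivariant**: `R f ⟦p κ⟧ = σ p (R f ⟦κ⟧)` for `p ∈ K` with `p ∈ H`. [cite: BernsteinZelevinsky1977, §2.3] -/
theorem restrictQuot_equivariant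
    (R : ↥((smoothIndRep H σ).fixedPoints K') →ₗ[k] (↥K ⧸ K'.subgroupOf K → W))
    (hR : ∀ (f : ↥((smoothIndRep H σ).fixedPoints K')) (κ : K), R f (QuotientGroup.mk κ) = (f : SmoothInd H σ).toFun (κ : G))
    (f : ↥((smoothIndRep H σ).fixedPoints K')) (p : K) (hp : (p : G) ∈ H) (κ : K) :
    R f (QuotientGroup.mk (p * κ)) = σ ⟨(p : G), hp⟩ (R f (QuotientGroup.mk κ)) := by
  rw [hR, hR, Subgroup.coe_mul]
  exact (f : SmoothInd H σ).toFun_subgroup_mul ⟨(p : G), hp⟩ (κ : G)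

/-! ## §2 The image: equivariant functions on `K ⧸ K′` -/

variable {H K σ K'} in
/-- **Every `(H ∩ K, σ)`-equivariant `F : K ⧸ K′ → W` is the restriction of a `K′`-fixed vector** (`K′` open, `K′ ≤ K`, `G = H · K`): the vector
`f(hκ) = σ h F⟦κ⟧` is well defined by equivariance, `H`-equivariant, right-`K′`-invariant, and smooth because the open `K′` fixes it.
[cite: CartierCorvallis1979, §III.3] [cite: BernsteinZelevinsky1977, §2.3] -/
theorem exists_preimage_of_equivariant (hK'o : IsOpen (K' : Set G)) (hK'K : K' ≤ K)
    (hGK : ∀ g : G, ∃ h : H, ∃ κ ∈ K, g = h * κ)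
    (R : ↥((smoothIndRep H σ).fixedPoints K') →ₗ[k] (↥K ⧸ K'.subgroupOf K → W))
    (hR : ∀ (f : ↥((smoothIndRep H σ).fixedPoints K')) (κ : K), R f (QuotientGroup.mk κ) = (f : SmoothInd H σ).toFun (κ : G))
    (F : ↥K ⧸ K'.subgroupOf K → W)
    (hF : ∀ (p : K) (hp : (p : G) ∈ H) (κ : K), F (QuotientGroup.mk (p * κ)) = σ ⟨(p : G), hp⟩ (F (QuotientGroup.mk κ))) :
    ∃ f : ↥((smoothIndRep H σ).fixedPoints K'), R f = F := by
  classical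
  choose hh κκ hκκ hdec using hGK
  -- the candidate function and its value on every decomposition `g = h κ`
  let Φ : G → W := fun g => σ (hh g) (F (QuotientGroup.mk ⟨κκ g, hκκ g⟩))
  have hwd : ∀ (h₁ h₂ : H) (κ₁ κ₂ : K), (h₁ : G) * κ₁ = h₂ * κ₂ →
      σ h₁ (F (QuotientGroup.mk κ₁)) = σ h₂ (F (QuotientGroup.mk κ₂)) := by
    intro h₁ h₂ κ₁ κ₂ heq
    -- `p := h₂⁻¹ h₁ = κ₂ κ₁⁻¹ ∈ H ∩ K`
    have hpK : ((h₂ : G)⁻¹ * h₁) ∈ K := by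
      have : (h₂ : G)⁻¹ * h₁ = κ₂ * (κ₁ : G)⁻¹ := by
        rw [inv_mul_eq_iff_eq_mul, ← mul_assoc, ← heq, mul_inv_cancel_right]
      rw [this]; exact K.mul_mem κ₂.2 (K.inv_mem κ₁.2)
    have hpH : (((⟨(h₂ : G)⁻¹ * h₁, hpK⟩ : K) : G)) ∈ H := H.mul_mem (H.inv_mem h₂.2) h₁.2
    have hκ₂ : (⟨(h₂ : G)⁻¹ * h₁, hpK⟩ : K) * κ₁ = κ₂ := by
      refine Subtype.ext ?_
      rw [Subgroup.coe_mul, mul_assoc, heq, inv_mul_cancel_left]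
    have key := hF ⟨(h₂ : G)⁻¹ * h₁, hpK⟩ hpH κ₁
    rw [hκ₂] at key
    rw [key, ← Module.End.mul_apply, ← map_mul]
    have hh12 : h₁ = h₂ * ⟨(((⟨(h₂ : G)⁻¹ * h₁, hpK⟩ : K) : G)), hpH⟩ :=
      Subtype.ext (by rw [Subgroup.coe_mul]; exact (mul_inv_cancel_left (h₂ : G) h₁).symm)
    rw [← hh12]
  have hΦ : ∀ (g : G) (h : H) (κ : K), g = h * κ → Φ g = σ h (F (QuotientGroup.mk κ)) := fun g h κ hg =>
    hwd (hh g) h ⟨κκ g, hκκ g⟩ κ ((hdec g).symm.trans hg)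
  -- `H`-equivariance
  have hΦmem : Φ ∈ coindV H.subtype σ := by
    rw [mem_indFun_iff]
    intro h g
    rw [hΦ (h * g) (h * hh g) ⟨κκ g, hκκ g⟩ (by rw [Subgroup.coe_mul, mul_assoc, ← hdec g]), map_mul, Module.End.mul_apply]
  -- right `K′`-invariance
  have hΦK : ∀ κ ∈ K', ∀ x : G, Φ (x * κ) = Φ x := fun κ hκ x => by
    have hq : (QuotientGroup.mk (⟨κκ x, hκκ x⟩ * ⟨κ, hK'K hκ⟩ : K) : ↥K ⧸ K'.subgroupOf K) = QuotientGroup.mk ⟨κκ x, hκκ x⟩ := by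
      rw [QuotientGroup.eq, Subgroup.mem_subgroupOf]
      simp only [mul_inv_rev, Subgroup.coe_inv, mul_assoc, inv_mul_cancel, mul_one]
      exact K'.inv_mem hκ
    rw [hΦ (x * κ) (hh x) (⟨κκ x, hκκ x⟩ * ⟨κ, hK'K hκ⟩) (by rw [Subgroup.coe_mul, ← mul_assoc, ← hdec x]), hq]
  -- smoothness: the stabiliser contains the open `K′`
  have hΦsm : (indFun H σ).IsSmoothVector (⟨Φ, hΦmem⟩ : coindV H.subtype σ) := by
    refine (indFun H σ).isSmoothVector_of_le hK'o fun κ hκ => ?_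
    rw [mem_stabilizerSubgroup]
    exact Subtype.ext (funext fun x => hΦK κ hκ x)
  let f : SmoothInd H σ := (⟨⟨Φ, hΦmem⟩, hΦsm⟩ : ↥(smoothInd H σ).toSubmodule)
  have hftoFun : f.toFun = Φ := rfl
  have hfK' : f ∈ (smoothIndRep H σ).fixedPoints K' := (mem_fixedPoints_smoothIndRep_iff H K' σ f).2 fun κ hκ x => by rw [hftoFun, hΦK κ hκ x]
  refine ⟨⟨f, hfK'⟩, funext fun q => Quotient.inductionOn q fun κ => ?_⟩
  show R ⟨f, hfK'⟩ (QuotientGroup.mk κ) = F (QuotientGroup.mk κ)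
  rw [hR, hftoFun, hΦ (κ : G) 1 κ (by rw [Subgroup.coe_one, one_mul]), map_one, Module.End.one_apply]

variable {H K σ K'} in
/-- **`(Ind_H^G σ)^{K′} ≅ {F : K ⧸ K′ → W (H ∩ K, σ)-equivariant}`**: the image of the restriction map is exactly the equivariant functions (`K′` open, `K′ ≤ K`,
`G = H · K`). [cite: CartierCorvallis1979, §III.3] [cite: BernsteinZelevinsky1977, §2.3] -/
theorem mem_range_restrictQuot_iff (hK'o : IsOpen (K' : Set G)) (hK'K : K' ≤ K)
    (hGK : ∀ g : G, ∃ h : H, ∃ κ ∈ K, g = h * κ)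
    (R : ↥((smoothIndRep H σ).fixedPoints K') →ₗ[k] (↥K ⧸ K'.subgroupOf K → W))
    (hR : ∀ (f : ↥((smoothIndRep H σ).fixedPoints K')) (κ : K), R f (QuotientGroup.mk κ) = (f : SmoothInd H σ).toFun (κ : G))
    (F : ↥K ⧸ K'.subgroupOf K → W) :
    F ∈ LinearMap.range R ↔ ∀ (p : K) (hp : (p : G) ∈ H) (κ : K), F (QuotientGroup.mk (p * κ)) = σ ⟨(p : G), hp⟩ (F (QuotientGroup.mk κ)) := by
  constructor
  · rintro ⟨f, rfl⟩ p hp κ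
    exact restrictQuot_equivariant R hR f p hp κ
  · intro hF
    obtain ⟨f, hf⟩ := exists_preimage_of_equivariant hK'o hK'K hGK R hR F hF
    exact ⟨f, hf⟩

end Representation

end
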